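import Mathlib
import Literature.Analysis.FluidPDE.SteadyEulerVelocityTesting
import HarnessLib

/-!
# Crux `EulerZoomLiouville.PowerGaugeEulerLiouville` (stmt-NavierStokesRegularity-19832), weak stratum, line `weak_lagrangian` (ns-idea-11 g9):
# TOOLS FOR THE SOBOLEV HALF OF `stub_chainRule` (F2) — a.e.-convergent subsequences from `∫Fₙ → 0`, local `L^{3/2}` convergence of mollified
# gradients, and the Hölder pairing against `W ∈ L³_loc`

Route №10 `EulerZoomLiouville` (NavierStokesRegularity), crux E = stmt-NavierStokesRegularity-19832; width seat ns-ezl-w1 g8 under the LEAD ns-typeII-p2 g14.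
Stage (C) of F2 (see `…WeakChainRuleSmooth`, `…WeakFlowJacobian`):

* `exists_seq_tendsto_ae_of_tendsto_lintegral` — **generic**: `∫ Fₙ dμ → 0` (`Fₙ ≥ 0` a.e.-measurable) ⇒ along some `m_k → ∞` (with `m_k ≥ N₀` prescribed),
  `F_{m_k}(x) → 0` for a.e. `x` (Borel–Cantelli with `∫F_{m_k} ≤ 2^{−k}`);
* `normed_convolution_indicator_eq` — locality of mollification: `(φ ⋆ 𝟙_s g)(x) = (φ ⋆ g)(x)` when `B(x, r_φ) ⊆ s`;
* `tendsto_setLIntegral_mollify_sub_rpow` — `g ∈ L^{3/2}(B(0,r))` for all `r` ⇒ `∫_{B(0,M)} ‖φₙ ⋆ g − g‖^{3/2} → 0` along any bump sequence with `r_φₙ → 0`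
  (tree `tendsto_eLpNorm_normed_convolution_sub` for the truncation `𝟙_{B(0,M+1)} g` + locality);
* `setLIntegral_mul_le_holder32` — `∫_{B} ‖a‖‖b‖ ≤ (∫_B‖a‖^{3/2})^{2/3} (∫_B‖b‖³)^{1/3}`; `tendsto_setLIntegral_mollify_sub_mul` — hence
  `∫_{B(0,M)} ‖φₙ ⋆ g − g‖ ‖W‖ → 0` for `W ∈ L³(B(0,M))`.

WHAT THIS IS NOT: not NS, not E, not F2 — analysis plumbing `--supports` stmt-19832; 19832 is OPEN. [folklore; Evans2010 §5.3.1 Thm. 1, App. C.4 Thm. 7]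
-/

noncomputable section

-- flat `Theorems/<Route><Decl>…` files of one crux share the namespace of the crux (tree convention)
set_option linter.dupNamespace false

open MeasureTheory Set Filter Topology Metric Function TopologicalSpace ContinuousLinearMap
open scoped ENNReal NNReal Convolution InnerProductSpace RealInnerProductSpace ContDiff

namespace Summit.NavierStokesRegularity.NavierStokesRegularity.Theorems.PowerGaugeEulerLiouville.WeakLagrangian

open Literature.Analysis Literature.Analysis.FunctionSpaces Literature.Analysis.FluidPDE

/-! ### From `∫ Fₙ → 0` to an a.e.-convergent subsequence -/

/-- **Borel–Cantelli subsequence**: if `∫ Fₙ dμ → 0` for a.e.-measurable `Fₙ : α → [0,∞]`, then there is `m : ℕ → ℕ` with `m k ≥ N₀`, `m k → ∞` and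
`F_{m k}(x) → 0` for a.e. `x`. [folklore] -/
theorem exists_seq_tendsto_ae_of_tendsto_lintegral {α : Type*} [MeasurableSpace α] {μ : Measure α} {F : ℕ → α → ℝ≥0∞}
    (hF : ∀ n, AEMeasurable (F n) μ) (h : Tendsto (fun n => ∫⁻ x, F n x ∂μ) atTop (𝓝 0)) (N₀ : ℕ) :
    ∃ m : ℕ → ℕ, (∀ k, N₀ ≤ m k) ∧ Tendsto m atTop atTop ∧ ∀ᵐ x ∂μ, Tendsto (fun k => F (m k) x) atTop (𝓝 0) := by
  rw [ENNReal.tendsto_atTop_zero] at h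
  have hε : ∀ k : ℕ, (0 : ℝ≥0∞) < (2⁻¹ : ℝ≥0∞) ^ k := fun k => ENNReal.pow_pos (by norm_num) k
  choose N hN using fun k : ℕ => h ((2⁻¹ : ℝ≥0∞) ^ k) (hε k)
  refine ⟨fun k => max (max k N₀) (N k), fun k => (le_max_right _ _).trans (le_max_left _ _), ?_, ?_⟩
  · exact tendsto_atTop_mono (fun k => (le_max_left _ _).trans (le_max_left _ _)) tendsto_id
  · have hsum : ∫⁻ x, ∑' k, F (max (max k N₀) (N k)) x ∂μ ≠ ⊤ := by
      rw [lintegral_tsum fun k => hF _]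
      refine ne_of_lt (lt_of_le_of_lt (ENNReal.tsum_le_tsum fun k => hN k _ (le_max_right _ _)) ?_)
      rw [ENNReal.tsum_geometric, ENNReal.one_sub_inv_two, inv_inv]
      exact ENNReal.ofNat_lt_top
    filter_upwards [ae_lt_top' (AEMeasurable.tsum fun k => hF _) hsum] with x hx
    exact ENNReal.tendsto_atTop_zero_of_tsum_ne_top hx.ne

/-! ### Locality and local `L^{3/2}` convergence of mollified gradients -/

section Mollify

variable {F : Type*} [NormedAddCommGroup F] [NormedSpace ℝ F] [CompleteSpace F]

omit [CompleteSpace F] in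
/-- **Locality of mollification**: `(φ ⋆ 𝟙_s g)(x) = (φ ⋆ g)(x)` as soon as `B(x, r_φ) ⊆ s`. [folklore] -/
theorem normed_convolution_indicator_eq (φ : ContDiffBump (0 : EuclideanSpace ℝ (Fin 3))) {g : EuclideanSpace ℝ (Fin 3) → F}
    {s : Set (EuclideanSpace ℝ (Fin 3))} {x : EuclideanSpace ℝ (Fin 3)} (hx : ball x φ.rOut ⊆ s) :
    (φ.normed volume ⋆[lsmul ℝ ℝ, volume] s.indicator g) x = (φ.normed volume ⋆[lsmul ℝ ℝ, volume] g) x := by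
  rw [convolution_def, convolution_def]
  refine integral_congr_ae (Eventually.of_forall fun t => ?_)
  simp only [lsmul_apply]
  by_cases ht : t ∈ ball (0 : EuclideanSpace ℝ (Fin 3)) φ.rOut
  · have hmem : x - t ∈ s := by
      refine hx ?_
      rw [mem_ball, dist_eq_norm, sub_sub_cancel_left, norm_neg]
      rwa [mem_ball, dist_zero_right] at ht
    rw [indicator_of_mem hmem]
  · have h0 : φ.normed volume t = 0 := by
      have : t ∉ support (φ.normed volume) := by rwa [φ.support_normed_eq]
      simpa [mem_support] using this
    rw [h0, zero_smul, zero_smul]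

/-- **Local `L^{3/2}` convergence of mollifications**: `g ∈ L^{3/2}(B(0,r))` for every `r`, a.e.-strongly measurable; then along any bump sequence with
`r_φₙ → 0`, `∫_{B(0,M)} ‖φₙ ⋆ g − g‖^{3/2} → 0`. [folklore; Evans2010 App. C.4 Thm. 7 (iii)] -/
theorem tendsto_setLIntegral_mollify_sub_rpow {φ : ℕ → ContDiffBump (0 : EuclideanSpace ℝ (Fin 3))}
    (hφ : Tendsto (fun n => (φ n).rOut) atTop (𝓝 0)) {g : EuclideanSpace ℝ (Fin 3) → F}
    (hg : ∀ r : ℝ, MemLp g (3 / 2 : ℝ≥0∞) (volume.restrict (ball (0 : EuclideanSpace ℝ (Fin 3)) r)))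
    (M : ℝ) :
    Tendsto (fun n => ∫⁻ z in ball (0 : EuclideanSpace ℝ (Fin 3)) M, ‖((φ n).normed volume ⋆[lsmul ℝ ℝ, volume] g) z - g z‖ₑ ^ (3 / 2 : ℝ))
      atTop (𝓝 0) := by
  set ψ : EuclideanSpace ℝ (Fin 3) → F := (ball (0 : EuclideanSpace ℝ (Fin 3)) (M + 1)).indicator g with hψ
  have hψm : MemLp ψ (3 / 2 : ℝ≥0∞) volume := by
    rw [hψ, memLp_indicator_iff_restrict measurableSet_ball]
    exact hg (M + 1)
  have h32 : (1 : ℝ≥0∞) ≤ 3 / 2 := by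
    rw [ENNReal.le_div_iff_mul_le (Or.inl two_ne_zero) (Or.inl ENNReal.ofNat_ne_top)]; norm_num
  have h32t : (3 / 2 : ℝ≥0∞) ≠ ⊤ := ENNReal.div_ne_top ENNReal.ofNat_ne_top two_ne_zero
  have hconv := tendsto_eLpNorm_normed_convolution_sub hφ h32 h32t hψm
  -- eventually `r_φₙ ≤ 1`
  have hsmall : ∀ᶠ n in atTop, (φ n).rOut ≤ 1 := (hφ.eventually (gt_mem_nhds one_pos)).mono fun n hn => hn.le
  -- `eLpNorm → 0` ⇒ its `3/2`-power `→ 0`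
  have hpow : Tendsto (fun n => eLpNorm ((φ n).normed volume ⋆[lsmul ℝ ℝ, volume] ψ - ψ) (3 / 2 : ℝ≥0∞) volume ^ (3 / 2 : ℝ))
      atTop (𝓝 0) := by
    have h0 : (0 : ℝ≥0∞) ^ (3 / 2 : ℝ) = 0 := ENNReal.zero_rpow_of_pos (by norm_num)
    rw [← h0]
    exact (ENNReal.continuous_rpow_const.tendsto 0).comp hconv
  have htoR : (3 / 2 : ℝ≥0∞).toReal = 3 / 2 := by
    rw [ENNReal.toReal_div]; norm_num
  refine tendsto_of_tendsto_of_tendsto_of_le_of_le' tendsto_const_nhds hpow (Eventually.of_forall fun n => bot_le) ?_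
  filter_upwards [hsmall] with n hn
  -- on `B(0,M)` the two mollifications agree, and `ψ = g`
  have heq : ∀ z ∈ ball (0 : EuclideanSpace ℝ (Fin 3)) M,
      ‖((φ n).normed volume ⋆[lsmul ℝ ℝ, volume] g) z - g z‖ₑ ^ (3 / 2 : ℝ) =
        ‖((φ n).normed volume ⋆[lsmul ℝ ℝ, volume] ψ - ψ) z‖ₑ ^ (3 / 2 : ℝ) := by
    intro z hz
    have hzM : z ∈ ball (0 : EuclideanSpace ℝ (Fin 3)) (M + 1) := ball_subset_ball (by linarith) hz
    have hsub : ball z (φ n).rOut ⊆ ball (0 : EuclideanSpace ℝ (Fin 3)) (M + 1) := by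
      intro t ht
      rw [mem_ball, dist_zero_right]
      rw [mem_ball, dist_eq_norm] at ht
      rw [mem_ball, dist_zero_right] at hz
      calc ‖t‖ = ‖(t - z) + z‖ := by rw [sub_add_cancel]
        _ ≤ ‖t - z‖ + ‖z‖ := norm_add_le _ _
        _ < M + 1 := by linarith
    rw [Pi.sub_apply, hψ, normed_convolution_indicator_eq (φ n) hsub, indicator_of_mem hzM]
  rw [setLIntegral_congr_fun measurableSet_ball heq]
  calc ∫⁻ z in ball (0 : EuclideanSpace ℝ (Fin 3)) M, ‖((φ n).normed volume ⋆[lsmul ℝ ℝ, volume] ψ - ψ) z‖ₑ ^ (3 / 2 : ℝ)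
      ≤ ∫⁻ z, ‖((φ n).normed volume ⋆[lsmul ℝ ℝ, volume] ψ - ψ) z‖ₑ ^ (3 / 2 : ℝ) := setLIntegral_le_lintegral _ _
    _ = eLpNorm ((φ n).normed volume ⋆[lsmul ℝ ℝ, volume] ψ - ψ) (3 / 2 : ℝ≥0∞) volume ^ (3 / 2 : ℝ) := by
        rw [eLpNorm_eq_lintegral_rpow_enorm_toReal (by positivity) h32t, htoR, ← ENNReal.rpow_mul]
        norm_num

/-! ### The Hölder pairing `L^{3/2} × L³ → L¹` on balls -/

/-- `∫_B ‖a‖‖b‖ ≤ (∫_B ‖a‖^{3/2})^{2/3} (∫_B ‖b‖³)^{1/3}` (Hölder, `(3/2)⁻¹ + 3⁻¹ = 1`). [folklore] -/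
theorem setLIntegral_mul_le_holder32 {G₁ G₂ : Type*} [NormedAddCommGroup G₁] [NormedAddCommGroup G₂]
    {a : EuclideanSpace ℝ (Fin 3) → G₁} {b : EuclideanSpace ℝ (Fin 3) → G₂} {s : Set (EuclideanSpace ℝ (Fin 3))}
    (ha : AEStronglyMeasurable a (volume.restrict s)) (hb : AEStronglyMeasurable b (volume.restrict s)) :
    ∫⁻ z in s, ‖a z‖ₑ * ‖b z‖ₑ ≤
      (∫⁻ z in s, ‖a z‖ₑ ^ (3 / 2 : ℝ)) ^ (1 / (3 / 2 : ℝ)) * (∫⁻ z in s, ‖b z‖ₑ ^ (3 : ℝ)) ^ (1 / (3 : ℝ)) := by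
  have hpq : (3 / 2 : ℝ).HolderConjugate 3 := by
    rw [Real.holderConjugate_iff]; norm_num
  exact ENNReal.lintegral_mul_le_Lp_mul_Lq _ hpq ha.enorm hb.enorm

/-- **`∫_{B(0,M)} ‖φₙ ⋆ g − g‖ ‖W‖ → 0`** for `g ∈ L^{3/2}_loc`, `W ∈ L³(B(0,M))`, along any bump sequence with `r_φₙ → 0`. [folklore] -/
theorem tendsto_setLIntegral_mollify_sub_mul {φ : ℕ → ContDiffBump (0 : EuclideanSpace ℝ (Fin 3))}
    (hφ : Tendsto (fun n => (φ n).rOut) atTop (𝓝 0)) {g : EuclideanSpace ℝ (Fin 3) → F}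
    (hgm : AEStronglyMeasurable g volume) (hg : ∀ r : ℝ, MemLp g (3 / 2 : ℝ≥0∞) (volume.restrict (ball (0 : EuclideanSpace ℝ (Fin 3)) r)))
    {G₂ : Type*} [NormedAddCommGroup G₂] {W : EuclideanSpace ℝ (Fin 3) → G₂} {M : ℝ}
    (hW : MemLp W 3 (volume.restrict (ball (0 : EuclideanSpace ℝ (Fin 3)) M))) :
    Tendsto (fun n => ∫⁻ z in ball (0 : EuclideanSpace ℝ (Fin 3)) M, ‖((φ n).normed volume ⋆[lsmul ℝ ℝ, volume] g) z - g z‖ₑ * ‖W z‖ₑ)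
      atTop (𝓝 0) := by
  have hgl : LocallyIntegrable g volume := by
    refine fun x => ⟨ball 0 (‖x‖ + 1), isOpen_ball.mem_nhds (by rw [mem_ball, dist_zero_right]; linarith), ?_⟩
    haveI : IsFiniteMeasure ((volume : Measure (EuclideanSpace ℝ (Fin 3))).restrict (ball 0 (‖x‖ + 1))) :=
      isFiniteMeasure_restrict.2 measure_ball_lt_top.ne
    have h32 : (1 : ℝ≥0∞) ≤ 3 / 2 := by
      rw [ENNReal.le_div_iff_mul_le (Or.inl two_ne_zero) (Or.inl ENNReal.ofNat_ne_top)]; norm_num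
    exact ((hg (‖x‖ + 1)).mono_exponent (p := 1) h32).integrable le_rfl
  have hcont : ∀ n, Continuous ((φ n).normed volume ⋆[lsmul ℝ ℝ, volume] g) := fun n =>
    ((φ n).hasCompactSupport_normed (μ := volume)).continuous_convolution_left _ (φ n).continuous_normed hgl
  set B : ℝ≥0∞ := (∫⁻ z in ball (0 : EuclideanSpace ℝ (Fin 3)) M, ‖W z‖ₑ ^ (3 : ℝ)) ^ (1 / (3 : ℝ)) with hB
  have hBtop : B ≠ ⊤ := by
    refine ENNReal.rpow_ne_top_of_nonneg (by norm_num) (ne_of_lt ?_)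
    have h := (eLpNorm_lt_top_iff_lintegral_rpow_enorm_lt_top (by norm_num) ENNReal.ofNat_ne_top).1 hW.eLpNorm_lt_top
    simpa only [ENNReal.toReal_ofNat] using h
  have hpow : Tendsto (fun n => (∫⁻ z in ball (0 : EuclideanSpace ℝ (Fin 3)) M,
      ‖((φ n).normed volume ⋆[lsmul ℝ ℝ, volume] g) z - g z‖ₑ ^ (3 / 2 : ℝ)) ^ (1 / (3 / 2 : ℝ)) * B) atTop (𝓝 0) := by
    have h1 := tendsto_setLIntegral_mollify_sub_rpow hφ hg M
    have h2 : Tendsto (fun n => (∫⁻ z in ball (0 : EuclideanSpace ℝ (Fin 3)) M,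
        ‖((φ n).normed volume ⋆[lsmul ℝ ℝ, volume] g) z - g z‖ₑ ^ (3 / 2 : ℝ)) ^ (1 / (3 / 2 : ℝ))) atTop (𝓝 0) := by
      have h0 : (0 : ℝ≥0∞) ^ (1 / (3 / 2 : ℝ)) = 0 := ENNReal.zero_rpow_of_pos (by norm_num)
      rw [← h0]
      exact (ENNReal.continuous_rpow_const.tendsto 0).comp h1
    have h3 := ENNReal.Tendsto.mul_const h2 (Or.inr hBtop)
    rwa [zero_mul] at h3
  refine tendsto_of_tendsto_of_tendsto_of_le_of_le' tendsto_const_nhds hpow (Eventually.of_forall fun n => bot_le)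
    (Eventually.of_forall fun n => ?_)
  have ha : AEStronglyMeasurable (fun z => ((φ n).normed volume ⋆[lsmul ℝ ℝ, volume] g) z - g z)
      (volume.restrict (ball (0 : EuclideanSpace ℝ (Fin 3)) M)) :=
    ((hcont n).aestronglyMeasurable.sub hgm).restrict
  exact setLIntegral_mul_le_holder32 ha hW.1

end Mollify

end Summit.NavierStokesRegularity.NavierStokesRegularity.Theorems.PowerGaugeEulerLiouville.WeakLagrangian

end
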